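import Literature.Probability.Percolation.CutBlocks
import HarnessLib

/-!
# Flat stretches of the inner wall of the zones of a cut

Topic `Probability/Percolation`.  Support file (proofs, no named fact) for the named fact
`SchrammSmirnov2011_thm_1_7` (zone geometry of the proof of Prop. 4.1, Ann. Probab. 39 (2011), §4):
the local pattern of tube and collar sites across a FLAT STRETCH of the inner wall of
`CutBlocks.zones` — three consecutive tube blocks `z - (1,0)`, `z`, `z + (1,0)` whose upper
neighbours are not tube blocks.  In the three columns of blocks and at heights from the bottom of
block `z` up to (strictly) the top of the upper blocks, a site is a tube site iff it lies at or
below the common top edge, and a collar site iff it lies strictly above it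
(`mem_Nset_iff_of_flatTop`, `mem_Kset_iff_of_flatTop`): the pattern "`K` = a half-plane, no far
site" of a clean straight window (`CollarDatum.CleanWindow`, `CollarWindowArms.lean`), here for the
upward normal; the other three directions are symmetric.

## References

* O. Schramm, S. Smirnov, *On the scaling limits of planar percolation*, Ann. Probab. 39 (2011)
  1768–1814, arXiv:1101.5820, §4, proof of Prop. 4.1 ("each component `K_j` is a quad with two
  long sides on `β` and `β'`"). [SchrammSmirnov2011]
-/

noncomputable section

open Set Metric
open Literature.Probability.LatticeModels

namespace Literature.Probability.Percolation

namespace CutBlocks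

variable {s : ℝ} {α : Set ℂ} {δ : ℝ}

/-- **A flat stretch of the upper inner wall**: three consecutive tube blocks whose upper neighbours
are not tube blocks. [folklore] -/
structure FlatTop (s : ℝ) (α : Set ℂ) (z : ℤ × ℤ) : Prop where
  mid : z ∈ tubeBlocks s α
  left : (z.1 - 1, z.2) ∈ tubeBlocks s α
  right : (z.1 + 1, z.2) ∈ tubeBlocks s α
  up_mid : (z.1, z.2 + 1) ∉ tubeBlocks s α
  up_left : (z.1 - 1, z.2 + 1) ∉ tubeBlocks s α
  up_right : (z.1 + 1, z.2 + 1) ∉ tubeBlocks s α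

/-- The blocks containing a point of the three columns at the heights of the upper blocks (strictly
inside them vertically) are the three upper blocks. [folklore] -/
theorem block_eq_of_mem_upper (hs : 0 < s) {z b : ℤ × ℤ} {w : ℂ} (hw : w ∈ block s b)
    (h1 : s * (z.1 - 1) ≤ w.re) (h2 : w.re ≤ s * (z.1 + 2)) (h3 : s * (z.2 + 1) < w.im) (h4 : w.im < s * (z.2 + 2)) :
    b.2 = z.2 + 1 ∧ (b.1 = z.1 - 1 ∨ b.1 = z.1 ∨ b.1 = z.1 + 1 ∨ (b.1 = z.1 - 2 ∧ w.re = s * (z.1 - 1)) ∨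
      (b.1 = z.1 + 2 ∧ w.re = s * (z.1 + 2))) := by
  obtain ⟨hb1, hb2, hb3, hb4⟩ := hw
  have e3 : (z.2 : ℝ) < b.2 := by nlinarith
  have e4 : (b.2 : ℝ) < z.2 + 2 := by nlinarith
  have f3 : z.2 < b.2 := by exact_mod_cast e3
  have f4 : b.2 < z.2 + 2 := by exact_mod_cast e4
  refine ⟨by omega, ?_⟩
  have e1 : ((z.1 - 2 : ℤ) : ℝ) < b.1 + 1 := by push_cast; nlinarith
  have e2 : (b.1 : ℝ) < ((z.1 + 3 : ℤ) : ℝ) := by push_cast; nlinarith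
  have f1 : z.1 - 2 < b.1 + 1 := by exact_mod_cast e1
  have f2 : b.1 < z.1 + 3 := by exact_mod_cast e2
  rcases (show b.1 = z.1 - 2 ∨ b.1 = z.1 - 1 ∨ b.1 = z.1 ∨ b.1 = z.1 + 1 ∨ b.1 = z.1 + 2 by omega) with h | h | h | h | h
  · refine Or.inr (Or.inr (Or.inr (Or.inl ⟨h, le_antisymm ?_ h1⟩)))
    have : (b.1 : ℝ) = z.1 - 2 := by exact_mod_cast h
    nlinarith
  · exact Or.inl h
  · exact Or.inr (Or.inl h)
  · exact Or.inr (Or.inr (Or.inl h))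
  · refine Or.inr (Or.inr (Or.inr (Or.inr ⟨h, le_antisymm h2 ?_⟩)))
    have : (b.1 : ℝ) = z.1 + 2 := by exact_mod_cast h
    nlinarith

/-- **Above a flat stretch there are no tube sites**: a site of the three columns strictly above the
top edge and strictly below the top of the upper blocks is not a tube site — provided the blocks two
columns away at that level are not tube blocks either when the site sits exactly on their edge; we
simply keep away from those edges by one mesh: columns in `[s(z.1-1) + δ, s(z.1+2) - δ]`. [folklore] -/
theorem not_mem_Nset_of_flatTop (hs : 0 < s) {z : ℤ × ℤ} (hz : FlatTop s α z) {v : Site 2}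
    (h1 : s * (z.1 - 1) < δ * v 0) (h2 : δ * v 0 < s * (z.1 + 2)) (h3 : s * (z.2 + 1) < δ * v 1)
    (h4 : δ * v 1 < s * (z.2 + 2)) : v ∉ Nset s α δ := by
  rintro ⟨b, hb, hvb⟩
  have key := block_eq_of_mem_upper hs (z := z) hvb (by rw [meshPoint_re]; exact h1.le) (by rw [meshPoint_re]; exact h2.le)
    (by rw [meshPoint_im]; exact h3) (by rw [meshPoint_im]; exact h4)
  obtain ⟨hb2, hb1⟩ := key
  rcases hb1 with h | h | h | ⟨-, h⟩ | ⟨-, h⟩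
  · exact hz.up_left (by rwa [show ((z.1 - 1, z.2 + 1) : ℤ × ℤ) = b from Prod.ext h.symm hb2.symm])
  · exact hz.up_mid (by rwa [show ((z.1, z.2 + 1) : ℤ × ℤ) = b from Prod.ext h.symm hb2.symm])
  · exact hz.up_right (by rwa [show ((z.1 + 1, z.2 + 1) : ℤ × ℤ) = b from Prod.ext h.symm hb2.symm])
  · rw [meshPoint_re] at h; linarith
  · rw [meshPoint_re] at h; linarith

/-- **Below the top edge of a flat stretch every site of the three columns is a tube site** (down to
the bottom of the blocks). [folklore] -/
theorem mem_Nset_of_flatTop {z : ℤ × ℤ} (hz : FlatTop s α z) {v : Site 2}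
    (h1 : s * (z.1 - 1) ≤ δ * v 0) (h2 : δ * v 0 ≤ s * (z.1 + 2)) (h3 : s * z.2 ≤ δ * v 1)
    (h4 : δ * v 1 ≤ s * (z.2 + 1)) : v ∈ Nset s α δ := by
  -- the column of `v` decides the block
  by_cases hl : δ * v 0 ≤ s * z.1
  · refine ⟨_, hz.left, ?_⟩
    simp only [block, mem_setOf_eq, meshPoint_re, meshPoint_im]
    push_cast
    exact ⟨by linarith, by linarith, h3, h4⟩
  by_cases hr : s * (z.1 + 1) ≤ δ * v 0
  · refine ⟨_, hz.right, ?_⟩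
    simp only [block, mem_setOf_eq, meshPoint_re, meshPoint_im]
    push_cast
    exact ⟨by linarith, by linarith, h3, h4⟩
  · push Not at hl hr
    refine ⟨_, hz.mid, ?_⟩
    simp only [block, mem_setOf_eq, meshPoint_re, meshPoint_im]
    exact ⟨hl.le, hr.le, h3, h4⟩

/-- **The tube pattern across a flat stretch**: in the three columns (one mesh away from their outer
edges) and at heights from the bottom of block `z` to strictly below the top of the upper blocks, a
site is a tube site iff it lies at or below the top edge. [cite: SchrammSmirnov2011, §4, proof of Prop. 4.1] -/
theorem mem_Nset_iff_of_flatTop (hs : 0 < s) {z : ℤ × ℤ} (hz : FlatTop s α z) {v : Site 2}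
    (h1 : s * (z.1 - 1) < δ * v 0) (h2 : δ * v 0 < s * (z.1 + 2)) (h3 : s * z.2 ≤ δ * v 1)
    (h4 : δ * v 1 < s * (z.2 + 2)) : v ∈ Nset s α δ ↔ δ * v 1 ≤ s * (z.2 + 1) := by
  constructor
  · intro hv
    by_contra h
    push Not at h
    exact not_mem_Nset_of_flatTop hs hz h1 h2 h h4 hv
  · exact fun h => mem_Nset_of_flatTop hz h1.le h2.le h3 h

/-- **The collar pattern across a flat stretch**: in the same range, a site is a collar site iff it
lies strictly above the top edge. [cite: SchrammSmirnov2011, §4, proof of Prop. 4.1] -/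
theorem mem_Kset_iff_of_flatTop (hs : 0 < s) {z : ℤ × ℤ} (hz : FlatTop s α z) {v : Site 2}
    (h1 : s * (z.1 - 1) < δ * v 0) (h2 : δ * v 0 < s * (z.1 + 2)) (h3 : s * z.2 ≤ δ * v 1)
    (h4 : δ * v 1 < s * (z.2 + 2)) : v ∈ Kset s α δ ↔ s * (z.2 + 1) < δ * v 1 := by
  constructor
  · rintro ⟨-, hvN⟩
    by_contra h
    push Not at h
    exact hvN (mem_Nset_of_flatTop hz h1.le h2.le h3 h)
  · intro h
    have hvN : v ∉ Nset s α δ := not_mem_Nset_of_flatTop hs hz h1 h2 h h4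
    refine ⟨⟨blockOf s (meshPoint δ v), ⟨?_, ?_⟩, mem_block_blockOf hs _⟩, hvN⟩
    · exact fun hb => hvN ⟨_, hb, mem_block_blockOf hs _⟩
    · -- the block of `v` is an upper block, adjacent to a tube block below it
      have key := block_eq_of_mem_upper hs (z := z) (mem_block_blockOf hs (meshPoint δ v))
        (by rw [meshPoint_re]; exact h1.le) (by rw [meshPoint_re]; exact h2.le)
        (by rw [meshPoint_im]; exact h) (by rw [meshPoint_im]; exact h4)
      obtain ⟨hb2, hb1⟩ := key
      rcases hb1 with hb | hb | hb | ⟨-, hb⟩ | ⟨-, hb⟩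
      · exact ⟨_, hz.left, by simp [hb], by simp [hb2]⟩
      · exact ⟨_, hz.mid, by simp [hb], by simp [hb2]⟩
      · exact ⟨_, hz.right, by simp [hb], by simp [hb2]⟩
      · rw [meshPoint_re] at hb; linarith
      · rw [meshPoint_re] at hb; linarith

/-- **No far site near a flat stretch**: every site of the range is a tube or a collar site. [folklore] -/
theorem mem_Nset_or_Kset_of_flatTop (hs : 0 < s) {z : ℤ × ℤ} (hz : FlatTop s α z) {v : Site 2}
    (h1 : s * (z.1 - 1) < δ * v 0) (h2 : δ * v 0 < s * (z.1 + 2)) (h3 : s * z.2 ≤ δ * v 1)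
    (h4 : δ * v 1 < s * (z.2 + 2)) : v ∈ Nset s α δ ∨ v ∈ Kset s α δ := by
  rcases le_or_gt (δ * v 1) (s * (z.2 + 1)) with h | h
  · exact Or.inl ((mem_Nset_iff_of_flatTop hs hz h1 h2 h3 h4).2 h)
  · exact Or.inr ((mem_Kset_iff_of_flatTop hs hz h1 h2 h3 h4).2 h)

end CutBlocks

end Literature.Probability.Percolation

end
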